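import Literature.AlgebraicGeometry.Motives.WeilTypeCM
import HarnessLib

/-!
# Discharged facts: the derivation action of `End M` on `⋀ⁿ M` (scalars, commuting pairs)

`Literature.AlgebraicGeometry.Motives.WeilTypeCM` defines the derivation extension
`Literature.derivationExteriorPower φ n : End_R (⋀[R]^n M)` of an endomorphism `φ : End_R M`,
`D_φ (v₁ ∧ ⋯ ∧ vₙ) = Σᵢ v₁ ∧ ⋯ ∧ φ vᵢ ∧ ⋯ ∧ vₙ` (the action of `φ ∈ 𝔤𝔩(M)` on `⋀ⁿ M` as a
Lie algebra representation), and records two named facts about it: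

* `Literature.derivationExteriorPower_smul_one : Prop` — a scalar `φ = c • 1` acts by
  `D_{c • 1} = (n c) • 1`;
* `Literature.commute_derivationExteriorPower : Prop` — `D_φ` and `D_ψ` commute when `φ` and `ψ`
  commute.

This file proves both (`Literature.AlgebraicGeometry.Motives.derivationExteriorPower_smul_one_holds`,
`Literature.AlgebraicGeometry.Motives.commute_derivationExteriorPower_holds`), so users holding
`(h : derivationExteriorPower_smul_one)` / `(h : commute_derivationExteriorPower)` can discharge
the hypothesis. It is definition-free (proofs only); everything is over a commutative ring `R`
and an arbitrary `R`-module `M`.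

## Proofs

Both facts are identities between `R`-linear maps out of `⋀[R]^n M`, so it suffices to compare
the two sides on pure wedges `ιMulti v = v₁ ∧ ⋯ ∧ vₙ` (`exteriorPower.linearMap_ext`), where
the defining formula `derivationExteriorPower_ιMulti` applies.

* Scalars: by multilinearity (`AlternatingMap.map_update_smul`, `Function.update_eq_self`),
  `D_{c • 1} (v₁ ∧ ⋯ ∧ vₙ) = Σᵢ v₁ ∧ ⋯ ∧ (c vᵢ) ∧ ⋯ ∧ vₙ = Σᵢ c (v₁ ∧ ⋯ ∧ vₙ) = (n c) (v₁ ∧ ⋯ ∧ vₙ)`.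
* Commuting pairs: applying the defining formula twice
  (`derivationExteriorPower_apply_apply_ιMulti`),
  `D_φ D_ψ (v₁ ∧ ⋯ ∧ vₙ) = Σᵢ v₁ ∧ ⋯ ∧ φψ vᵢ ∧ ⋯ ∧ vₙ + Σ_{i ≠ j} (⋯ ∧ φ vᵢ ∧ ⋯ ∧ ψ vⱼ ∧ ⋯)`;
  the diagonal part only involves `φψ = ψφ`, and the off-diagonal part is symmetric under
  `(φ, i) ↔ (ψ, j)` (`Finset.sum_comm`, `Function.update_comm`). (In general the same
  computation gives `[D_φ, D_ψ] = D_{[φ, ψ]}`, i.e. `φ ↦ D_φ` is a Lie algebra homomorphism.)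

This is the product-rule calculus of Fulton–Harris, *Representation Theory*, Lecture 8: a
representation of a Lie algebra is a bracket-preserving map `𝔤 → 𝔤𝔩(V)` (Definition 8.11), a
Lie algebra acts on tensors by the Leibniz rule `X(v ⊗ w) = X(v) ⊗ w + v ⊗ X(w)` (8.12), so
that `X(v²) = 2 · v · X(v)` (8.13) and, on wedges,
`d/dt|₀ (A_t e₁ ∧ ⋯ ∧ A_t eₙ) = Σᵢ e₁ ∧ ⋯ ∧ X(eᵢ) ∧ ⋯ ∧ eₙ` (§8.2, first display, there for
a top wedge, `= Trace(X) · e₁ ∧ ⋯ ∧ eₙ`); for the scalar `X = c · 1` each of the `n` summands is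
`c · (e₁ ∧ ⋯ ∧ eₙ)`.

## References

* W. Fulton, J. Harris, *Representation Theory. A First Course*, Graduate Texts in Math. 129,
  Springer (1991), Lecture 8, §8.1, Definition 8.11 and (8.12)–(8.13), and §8.2 (first
  display). [FultonHarrisGTM129]
-/

noncomputable section

namespace Literature.AlgebraicGeometry.Motives

variable {R : Type*} [CommRing R] {M : Type*} [AddCommGroup M] [Module R M]

/-! ### Scalars -/

/-- **Discharge of `derivationExteriorPower_smul_one`.** A scalar `c • 1 ∈ End_R M` acts on
`⋀[R]^n M` through the derivation extension `D` by the scalar `n c`: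
`D_{c • 1} = (n c) • 1`, since `D_{c • 1} (v₁ ∧ ⋯ ∧ vₙ) = Σᵢ v₁ ∧ ⋯ ∧ (c vᵢ) ∧ ⋯ ∧ vₙ`
has `n` summands each equal to `c (v₁ ∧ ⋯ ∧ vₙ)` — the Leibniz-rule action of a Lie algebra
on tensors/wedges (Fulton–Harris, Lecture 8, (8.12)–(8.13) and the first display of §8.2,
`Σᵢ e₁ ∧ ⋯ ∧ X(eᵢ) ∧ ⋯ ∧ eₙ`). Proof: `exteriorPower.linearMap_ext` reduces to pure wedges,
then `derivationExteriorPower_ιMulti`, `AlternatingMap.map_update_smul`,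
`Function.update_eq_self`, `Finset.sum_const`. [cite: FultonHarrisGTM129, Lecture 8 §8.1 (8.12)–(8.13) and §8.2 first display] -/
theorem derivationExteriorPower_smul_one_holds :
    derivationExteriorPower_smul_one (R := R) (M := M) := by
  intro c n
  refine exteriorPower.linearMap_ext ?_
  ext v : 1
  simp only [LinearMap.compAlternatingMap_apply, derivationExteriorPower_ιMulti,
    LinearMap.smul_apply, Module.End.one_apply, AlternatingMap.map_update_smul,
    Function.update_eq_self, Finset.sum_const, Finset.card_univ, Fintype.card_fin, mul_smul]
  rw [Nat.cast_smul_eq_nsmul]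

/-! ### Commuting pairs -/

/-- The defining formula applied twice: `D_φ (D_ψ (v₁ ∧ ⋯ ∧ vₙ))` is the double sum over
`(i, j)` of `v₁ ∧ ⋯ ∧ φ(ψ vᵢ) ∧ ⋯ ∧ vₙ` if `i = j`, and of the wedge with `vⱼ` replaced by
`ψ vⱼ` and `vᵢ` by `φ vᵢ` if `i ≠ j` (Leibniz rule, Fulton–Harris, Lecture 8, (8.12)). [folklore] -/
theorem derivationExteriorPower_apply_apply_ιMulti (φ ψ : Module.End R M) (n : ℕ)
    (v : Fin n → M) :
    derivationExteriorPower φ n (derivationExteriorPower ψ n (exteriorPower.ιMulti R n v)) =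
      ∑ j : Fin n, ∑ i : Fin n,
        if i = j then exteriorPower.ιMulti R n (Function.update v i (φ (ψ (v i))))
        else exteriorPower.ιMulti R n
          (Function.update (Function.update v j (ψ (v j))) i (φ (v i))) := by
  rw [derivationExteriorPower_ιMulti, map_sum]
  refine Finset.sum_congr rfl fun j _ => ?_
  rw [derivationExteriorPower_ιMulti]
  refine Finset.sum_congr rfl fun i _ => ?_
  by_cases hij : i = j
  · subst hij
    simp
  · rw [if_neg hij, Function.update_of_ne hij]

/-- **Discharge of `commute_derivationExteriorPower`.** If `φ` and `ψ` commute then so do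
their derivation extensions `D_φ`, `D_ψ` on `⋀[R]^n M` (the case `[φ, ψ] = 0` of the Lie
homomorphism property `[D_φ, D_ψ] = D_{[φ,ψ]}` of the Leibniz-rule action, Fulton–Harris,
Lecture 8, Definition 8.11 and (8.12)). Proof: on pure wedges (`exteriorPower.linearMap_ext`)
expand both composites by `derivationExteriorPower_apply_apply_ιMulti`; the diagonal terms agree
because `φψ = ψφ`, the off-diagonal ones after exchanging the summation indices
(`Finset.sum_comm`, `Function.update_comm`). [cite: FultonHarrisGTM129, Lecture 8 §8.1 Definition 8.11 and (8.12)] -/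
theorem commute_derivationExteriorPower_holds :
    commute_derivationExteriorPower (R := R) (M := M) := by
  intro φ ψ h n
  change derivationExteriorPower φ n * derivationExteriorPower ψ n =
    derivationExteriorPower ψ n * derivationExteriorPower φ n
  refine exteriorPower.linearMap_ext ?_
  ext v : 1
  simp only [LinearMap.compAlternatingMap_apply, Module.End.mul_apply,
    derivationExteriorPower_apply_apply_ιMulti]
  rw [Finset.sum_comm]
  refine Finset.sum_congr rfl fun x _ => Finset.sum_congr rfl fun y _ => ?_
  by_cases hxy : x = y
  · subst hxy
    have hc : φ (ψ (v x)) = ψ (φ (v x)) := congrArg (fun f : Module.End R M => f (v x)) h.eq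
    rw [if_pos rfl, if_pos rfl, hc]
  · rw [if_neg hxy, if_neg (Ne.symm hxy), Function.update_comm (Ne.symm hxy)]

end Literature.AlgebraicGeometry.Motives

end
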